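import Literature.Analysis.Complex.HolomorphicTaylorApprox
import Literature.Analysis.Complex.DbarPoincarePolydisc
import HarnessLib

/-!
# Uniform approximation by entire maps on closed sub-polydiscs (Hörmander, Thm. 2.2.6 / 2.7.3)

For `h : ℂ^ι → F` holomorphic on the polydisc `D(c, r)` and radii `t i < r i`, there are entire
maps `g` approximating `h` uniformly on the closed polydisc `∏ closedBall (c i) (t i)`
(`exists_entire_approx_on_closedPolydisc`): reduce to the unit ball of `ℂ^ι` (sup norm) by the
diagonal affine change of variables `z ↦ c + (r_i z_i)_i` and use the Taylor polynomials of
`Literature/Analysis/Complex/HolomorphicTaylorApprox.lean`. (Concentric polydiscs are a Runge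
pair; Hörmander (1973), Thm. 2.2.6 and Thm. 2.7.3 for polynomially convex compacts — here only the
elementary concentric case, as used in the proof of Thm. 2.7.8, `q = 0`.)

## References

* L. Hörmander, *An Introduction to Complex Analysis in Several Variables*, 2nd ed. (1973),
  Thm. 2.2.6, Thm. 2.7.3, proof of Thm. 2.7.8. [HormanderSCV1973]
-/

noncomputable section

open scoped Topology
open Complex Metric Set Filter

namespace Literature.Analysis.Complex

variable {ι : Type*} [Fintype ι] {F : Type*} [NormedAddCommGroup F] [NormedSpace ℂ F]

/-- The diagonal scaling `z ↦ (a_i z_i)_i` of `ℂ^ι` as a continuous `ℂ`-linear map. [folklore] -/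
def diagScale (a : ι → ℂ) : (ι → ℂ) →L[ℂ] (ι → ℂ) :=
  ContinuousLinearMap.pi fun i => a i • ContinuousLinearMap.proj i

omit [Fintype ι] in
/-- Values of `diagScale`. [folklore] -/
@[simp]
theorem diagScale_apply (a : ι → ℂ) (z : ι → ℂ) (i : ι) : diagScale a z i = a i * z i :=
  rfl

/-- For radii `t i < r i` with `0 < r i` there is `s ∈ (0,1)` with
`max (t i) 0 ≤ s * r i` for all `i` (finitely many conditions, each true for `s` near `1`).
[folklore] -/
theorem exists_scale_lt_one {r t : ι → ℝ} (hr : ∀ i, 0 < r i) (ht : ∀ i, t i < r i) :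
    ∃ s : ℝ, 0 < s ∧ s < 1 ∧ ∀ i, max (t i) 0 ≤ s * r i := by
  have h1 : ∀ i, ∀ᶠ s in 𝓝[<] (1 : ℝ), max (t i) 0 ≤ s * r i := by
    intro i
    have hlt : max (t i) 0 < 1 * r i := by rw [one_mul]; exact max_lt (ht i) (hr i)
    have hc : Tendsto (fun s : ℝ => s * r i) (𝓝[<] 1) (𝓝 (1 * r i)) :=
      ((continuous_id.mul continuous_const).tendsto 1).mono_left nhdsWithin_le_nhds
    exact (hc.eventually (lt_mem_nhds hlt)).mono fun s hs => hs.le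
  have h2 : ∀ᶠ s in 𝓝[<] (1 : ℝ), 0 < s ∧ s < 1 :=
    (eventually_nhdsWithin_of_eventually_nhds (lt_mem_nhds one_pos)).and
      (eventually_nhdsWithin_of_forall fun s hs => hs)
  obtain ⟨s, ⟨hs0, hs1⟩, hs⟩ := (h2.and (eventually_all.2 h1)).exists
  exact ⟨s, hs0, hs1, hs⟩

variable [CompleteSpace F]

/-- **Uniform approximation by entire maps on closed sub-polydiscs**: if `h : ℂ^ι → F` is
holomorphic on the polydisc `D(c, r)` and `t i < r i` for all `i`, then for every `ε > 0` there is
an entire map `g : ℂ^ι → F` with `‖h y - g y‖ ≤ ε` on the closed polydisc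
`∏ closedBall (c i) (t i)` (Hörmander (1973), Thm. 2.2.6: Taylor polynomials at the centre, after
the diagonal change of variables to the unit ball of `ℂ^ι`). [cite: HormanderSCV1973, Thm. 2.2.6] -/
theorem exists_entire_approx_on_closedPolydisc {h : (ι → ℂ) → F} {c : ι → ℂ} {r t : ι → ℝ}
    (hh : DifferentiableOn ℂ h (polydisc c r)) (ht : ∀ i, t i < r i) {ε : ℝ} (hε : 0 < ε) :
    ∃ g : (ι → ℂ) → F, Differentiable ℂ g ∧
      ∀ y ∈ Set.pi univ (fun i => closedBall (c i) (t i)), ‖h y - g y‖ ≤ ε := by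
  classical
  by_cases hr : ∀ i, 0 < r i
  swap
  · -- some radius is `≤ 0`: the closed polydisc is empty
    obtain ⟨i, hi⟩ := not_forall.mp hr
    refine ⟨0, differentiable_const 0, fun y hy => ?_⟩
    have hyi : y i ∈ closedBall (c i) (t i) := hy i (mem_univ i)
    have : t i < 0 := (ht i).trans_le (not_lt.mp hi)
    rw [closedBall_eq_empty.2 this] at hyi
    exact hyi.elim
  obtain ⟨s, hs0, hs1, hs⟩ := exists_scale_lt_one hr ht
  -- the change of variables `A w = c + (r_i w_i)`, `B y = ((y_i - c_i)/r_i)`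
  set A : (ι → ℂ) → (ι → ℂ) := fun w => c + diagScale (fun i => (r i : ℂ)) w with hA
  set B : (ι → ℂ) → (ι → ℂ) := fun y => diagScale (fun i => ((r i : ℂ))⁻¹) (y - c) with hB
  have hAB : ∀ y, A (B y) = y := by
    intro y; ext i
    simp only [hA, hB, Pi.add_apply, diagScale_apply, Pi.sub_apply]
    field_simp [(ofReal_ne_zero.2 (hr i).ne')]
    ring
  have hAd : Differentiable ℂ A := (differentiable_const c).add (diagScale _).differentiable
  have hBd : Differentiable ℂ B := (diagScale _).differentiable.comp (differentiable_id.sub_const c)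
  -- `A` maps the unit ball into the polydisc
  have hAball : ∀ w ∈ ball (0 : ι → ℂ) 1, A w ∈ polydisc c r := by
    intro w hw
    rw [mem_ball_zero_iff, pi_norm_lt_iff one_pos] at hw
    refine mem_polydisc.2 fun i => ?_
    rw [mem_ball, dist_eq_norm]
    simp only [hA, Pi.add_apply, diagScale_apply, add_sub_cancel_left, norm_mul, norm_real,
      Real.norm_eq_abs, abs_of_pos (hr i)]
    calc r i * ‖w i‖ < r i * 1 := by gcongr; exacts [hr i, hw i]
      _ = r i := mul_one _
  have hhA : DifferentiableOn ℂ (h ∘ A) (ball 0 1) :=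
    hh.comp hAd.differentiableOn fun w hw => hAball w hw
  obtain ⟨g, hg, hga⟩ := exists_entire_approx_on_closedBall (c := 0) (R := 1) hhA hs1 hε
  refine ⟨g ∘ B, hg.comp hBd, fun y hy => ?_⟩
  -- `B y` lies in the closed ball of radius `s`
  have hBy : B y ∈ closedBall (0 : ι → ℂ) s := by
    rw [mem_closedBall, dist_zero_right, pi_norm_le_iff_of_nonneg hs0.le]
    intro i
    have hyi : ‖y i - c i‖ ≤ max (t i) 0 :=
      (mem_closedBall_iff_norm.1 (hy i (mem_univ i))).trans (le_max_left _ _)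
    simp only [hB, diagScale_apply, Pi.sub_apply, norm_mul, norm_inv, norm_real, Real.norm_eq_abs,
      abs_of_pos (hr i)]
    rw [inv_mul_le_iff₀ (hr i)]
    calc ‖y i - c i‖ ≤ max (t i) 0 := hyi
      _ ≤ s * r i := hs i
      _ = r i * s := mul_comm _ _
  have := hga (B y) hBy
  simp only [Function.comp_apply, hAB] at this
  exact this

end Literature.Analysis.Complex
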